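import Literature.Analysis.FluidPDE.PassiveVectorTensorModeEnergy
import HarnessLib

/-!
# `L²` stability of weak passive-vector solutions (constant coercive viscosity tensor) under
# `L^∞` perturbations of the carrier

Analysis/FluidPDE proof-support file (everything proved; no definitions, no named facts). Two weak
solutions of `∂ₜw + (b·∇)w + A (w·∇)b + ∇π = 𝓛_𝔸 w`, `∇·w = 0` (Frisch's anisotropic eddy viscosity
(9.57), constant tensor in a Legendre–Hadamard window `NearIso 𝔸 lo hi`, `0 < lo`, NO symmetry) with
the SAME datum `w₀ ∈ L¹` but DIFFERENT bounded carriers — `w` along `b` (`‖b‖ ≤ M`), `u` along `b'`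
(`‖b'‖ ≤ M'`), `‖b − b'‖ ≤ δ` a.e. on `(0,T) × T^d` — stay `L²`-close:

* `ae_sq_norm_mFourierCoeff_sub_le` — the modewise bound for the difference:
  `‖ŵ(t)(k) − û(t)(k)‖² ≤ (d(1+A²)/(2 lo)) ∫_{(0,t]} ∑ⱼ (‖𝓕(bⱼw)(k) − 𝓕(b'ⱼu)(k)‖² + ‖𝓕(wⱼb)(k) − 𝓕(uⱼb')(k)‖²)`
  — the coupled mode system of `PassiveVectorTensorUniqueness` for `ŵ − û` (obtained by subtracting
  the two tested mode identities; the datum cancels), closed by `CoupledModeEnergyBound`;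
* `ae_lintegral_sq_sub_le_of_carriers` — **the stability estimate**: for a.e. `t ∈ (0,T)`,
  `∫⁻ ‖w(t) − u(t)‖ₑ² ≤ K δ² (∫⁻_{(0,T)} ∫⁻ ‖u‖ₑ²) · exp(K M² t)`, `K = 2 d² (1+A²)/lo`
  (Plancherel: `∑ₖ γₖ ≤ 4d (M² ‖w − u‖² + δ² ‖u‖²)` from `bⱼw − b'ⱼu = bⱼ(w − u) + (bⱼ − b'ⱼ)u`,
  `wⱼb − uⱼb' = (w − u)ⱼ b + uⱼ(b − b')`; then Grönwall a.e. in time).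

This is the energy-perturbation input of the K1L tail estimate (`stub_tailL` of
`LagrangianRenormalisationStep`, cell `ad-ideate`: the full carrier against its truncation at the
active level, same viscosity, same datum). With `δ = 0` it is the uniqueness theorem again.

## Mathlib / tree search

Tree: `PassiveVectorTensorUniqueness` (coupled mode system, coercivity `lo_mul_le_re_inner_symbT`,
`mem_orthogonal_waveVec_iff`), `CoupledModeEnergyBound.sum_sq_norm_le_of_ae_eq_setIntegral`,
`PassiveVectorTensorModeEnergy` (`ae_mFourierCoeff_zero_eq`, `exists_ae_norm_mFourierCoeff_le`),
`PassiveVectorTensorFourier` (`ae_inner_mFourierCoeff_eq`), `PerturbedEnergyGronwall.ae_gronwall_const`,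
`TorusVectorParseval.tsum_enorm_sq_mFourierCoeff_complexify`, `TorusTrigPoly` (`mFourierCoeff_sub`,
`complexify_comp_sub`). Evans 2010, §7.1.2 Thm. 2 (energy estimates); DiPerna–Lions 1989, §II.1
(stability of linear transport under perturbation of the field).

## References

* L. C. Evans, *Partial Differential Equations*, 2nd ed. (AMS 2010), §7.1.2 Thm. 2. [`Evans2010`]
* R. J. DiPerna, P.-L. Lions, Invent. Math. 98 (1989), §II.1, Thm. II.1/(12)–(14). [`DiPernaLions1989`]
* U. Frisch, *Turbulence* (CUP 1995), §9.6.3 eq. (9.57) p. 233. [`Frisch1995Turbulence`]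
* M. Giaquinta, *Multiple integrals in the calculus of variations and nonlinear elliptic systems*
  (Princeton 1983), Ch. III §2 (2.2). [`Giaquinta1983MultipleIntegrals`]
* L. Grafakos, *Classical Fourier Analysis*, 3rd ed., GTM 249 (2014), Prop. 3.2.7. [`Grafakos2014`]
-/

noncomputable section

open MeasureTheory Set Filter Function TopologicalSpace Complex UnitAddTorus
open scoped ENNReal NNReal InnerProductSpace ComplexConjugate

namespace Literature.Analysis.FluidPDE

namespace Torus

variable {d : Type*} [Fintype d]

/-! ## Linear algebra (local copies) -/

section LinearAlgebra

/-- `(a + |A| b)² ≤ (1 + A²)(a² + b²)`. [folklore] -/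
private theorem sq_add_abs_mul_le₆ (A a b : ℝ) : (a + |A| * b) ^ 2 ≤ (1 + A ^ 2) * (a ^ 2 + b ^ 2) := by
  nlinarith [sq_nonneg (|A| * a - b), sq_abs A]

/-- `‖B(z)‖² ≤ 4π²|k|² (‖z‖²(1 + A²) ∑ⱼ (‖Fⱼ‖² + ‖Gⱼ‖²))` (Cauchy–Schwarz). [folklore] -/
private theorem norm_sq_modeRHS_le₆ (A : ℝ) (k : d → ℤ) (z : EuclideanSpace ℂ d)
    (F G : d → EuclideanSpace ℂ d) :
    ‖(∑ j, (2 * Real.pi * I * (k j)) * ⟪F j, z⟫_ℂ) + (A : ℂ) * ∑ j, (2 * Real.pi * I * (k j)) * ⟪G j, z⟫_ℂ‖ ^ 2 ≤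
      (4 * Real.pi ^ 2 * FunctionSpaces.Torus.freqNormSq k) *
        (‖z‖ ^ 2 * (1 + A ^ 2) * ∑ j, (‖F j‖ ^ 2 + ‖G j‖ ^ 2)) := by
  have hkj : ∀ j, ‖(2 * Real.pi * I * (k j) : ℂ)‖ = 2 * Real.pi * |(k j : ℝ)| := by
    intro j
    rw [norm_mul, norm_mul, norm_mul, Complex.norm_I, mul_one, Complex.norm_intCast, Complex.norm_real,
      Real.norm_eq_abs, abs_of_pos Real.pi_pos, ← Int.cast_abs, Int.cast_abs]
    norm_num
  have h1 : ‖(∑ j, (2 * Real.pi * I * (k j)) * ⟪F j, z⟫_ℂ) + (A : ℂ) * ∑ j, (2 * Real.pi * I * (k j)) * ⟪G j, z⟫_ℂ‖ ≤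
      ∑ j, (2 * Real.pi * |(k j : ℝ)|) * (‖z‖ * (‖F j‖ + |A| * ‖G j‖)) := by
    rw [Finset.mul_sum, ← Finset.sum_add_distrib]
    refine (norm_sum_le _ _).trans (Finset.sum_le_sum fun j _ => ?_)
    have a1 : ‖(2 * Real.pi * I * (k j)) * ⟪F j, z⟫_ℂ‖ ≤ 2 * Real.pi * |(k j : ℝ)| * (‖F j‖ * ‖z‖) := by
      rw [norm_mul, hkj]
      exact mul_le_mul_of_nonneg_left (norm_inner_le_norm _ _) (by positivity)
    have a2 : ‖(A : ℂ) * ((2 * Real.pi * I * (k j)) * ⟪G j, z⟫_ℂ)‖ ≤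
        |A| * (2 * Real.pi * |(k j : ℝ)| * (‖G j‖ * ‖z‖)) := by
      rw [norm_mul, norm_mul, hkj, Complex.norm_real, Real.norm_eq_abs]
      exact mul_le_mul_of_nonneg_left (mul_le_mul_of_nonneg_left (norm_inner_le_norm _ _) (by positivity))
        (abs_nonneg _)
    calc ‖(2 * Real.pi * I * (k j)) * ⟪F j, z⟫_ℂ + (A : ℂ) * ((2 * Real.pi * I * (k j)) * ⟪G j, z⟫_ℂ)‖
        ≤ ‖(2 * Real.pi * I * (k j)) * ⟪F j, z⟫_ℂ‖ + ‖(A : ℂ) * ((2 * Real.pi * I * (k j)) * ⟪G j, z⟫_ℂ)‖ :=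
          norm_add_le _ _
      _ ≤ 2 * Real.pi * |(k j : ℝ)| * (‖F j‖ * ‖z‖) + |A| * (2 * Real.pi * |(k j : ℝ)| * (‖G j‖ * ‖z‖)) :=
          add_le_add a1 a2
      _ = 2 * Real.pi * |(k j : ℝ)| * (‖z‖ * (‖F j‖ + |A| * ‖G j‖)) := by ring
  have h2 : (∑ j, (2 * Real.pi * |(k j : ℝ)|) * (‖z‖ * (‖F j‖ + |A| * ‖G j‖))) ^ 2 ≤
      (∑ j, (2 * Real.pi * |(k j : ℝ)|) ^ 2) * ∑ j, (‖z‖ * (‖F j‖ + |A| * ‖G j‖)) ^ 2 :=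
    Finset.sum_mul_sq_le_sq_mul_sq _ _ _
  have h3 : ∑ j, (2 * Real.pi * |(k j : ℝ)|) ^ 2 = 4 * Real.pi ^ 2 * FunctionSpaces.Torus.freqNormSq k := by
    rw [FunctionSpaces.Torus.freqNormSq, Finset.mul_sum]
    exact Finset.sum_congr rfl fun j _ => by rw [mul_pow, sq_abs]; ring
  have h4 : ∑ j, (‖z‖ * (‖F j‖ + |A| * ‖G j‖)) ^ 2 ≤ ‖z‖ ^ 2 * (1 + A ^ 2) * ∑ j, (‖F j‖ ^ 2 + ‖G j‖ ^ 2) := by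
    rw [Finset.mul_sum]
    refine Finset.sum_le_sum fun j _ => ?_
    rw [mul_pow, mul_assoc]
    exact mul_le_mul_of_nonneg_left (sq_add_abs_mul_le₆ A _ _) (sq_nonneg _)
  calc ‖(∑ j, (2 * Real.pi * I * (k j)) * ⟪F j, z⟫_ℂ) + (A : ℂ) * ∑ j, (2 * Real.pi * I * (k j)) * ⟪G j, z⟫_ℂ‖ ^ 2
      ≤ (∑ j, (2 * Real.pi * |(k j : ℝ)|) * (‖z‖ * (‖F j‖ + |A| * ‖G j‖))) ^ 2 :=
        pow_le_pow_left₀ (norm_nonneg _) h1 2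
    _ ≤ (∑ j, (2 * Real.pi * |(k j : ℝ)|) ^ 2) * ∑ j, (‖z‖ * (‖F j‖ + |A| * ‖G j‖)) ^ 2 := h2
    _ ≤ (4 * Real.pi ^ 2 * FunctionSpaces.Torus.freqNormSq k) * (‖z‖ ^ 2 * (1 + A ^ 2) * ∑ j, (‖F j‖ ^ 2 + ‖G j‖ ^ 2)) := by
        rw [h3]
        have hN0 := FunctionSpaces.Torus.freqNormSq_nonneg k
        exact mul_le_mul_of_nonneg_left h4 (by positivity)

/-- Parseval in a subspace: `Σᵢ |⟪X, eᵢ⟫|² = ‖X‖²` for `X ∈ S`. [folklore] -/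
private theorem sum_sq_norm_inner_onb₆ {ι : Type*} [Fintype ι] {S : Submodule ℂ (EuclideanSpace ℂ d)}
    (b : OrthonormalBasis ι ℂ S) {X : EuclideanSpace ℂ d} (hX : X ∈ S) :
    ∑ i, ‖⟪X, (b i : EuclideanSpace ℂ d)⟫_ℂ‖ ^ 2 = ‖X‖ ^ 2 := by
  have h1 : ‖(⟨X, hX⟩ : S)‖ ^ 2 = ∑ i, ‖b.repr ⟨X, hX⟩ i‖ ^ 2 := by
    rw [← b.repr.norm_map, EuclideanSpace.norm_sq_eq]
  have h2 : ∀ i, b.repr ⟨X, hX⟩ i = ⟪(b i : EuclideanSpace ℂ d), X⟫_ℂ := fun i => by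
    rw [OrthonormalBasis.repr_apply_apply, Submodule.coe_inner]
  rw [show ‖X‖ = ‖(⟨X, hX⟩ : S)‖ from rfl, h1]
  refine Finset.sum_congr rfl fun i _ => ?_
  rw [h2, norm_inner_symm]

/-- Expansion in a subspace: `Σᵢ ⟪eᵢ, X⟫ eᵢ = X` for `X ∈ S`. [folklore] -/
private theorem sum_inner_smul_onb₆ {ι : Type*} [Fintype ι] {S : Submodule ℂ (EuclideanSpace ℂ d)}
    (b : OrthonormalBasis ι ℂ S) {X : EuclideanSpace ℂ d} (hX : X ∈ S) :
    ∑ i, ⟪(b i : EuclideanSpace ℂ d), X⟫_ℂ • (b i : EuclideanSpace ℂ d) = X := by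
  have h := b.sum_repr' ⟨X, hX⟩
  have h' := congrArg (fun v : S => (v : EuclideanSpace ℂ d)) h
  simp only [Submodule.coe_sum, Submodule.coe_smul, Submodule.coe_inner] at h'
  exact h'

/-- The basis vectors of an orthonormal basis of a subspace have norm one in the ambient space.
[folklore] -/
private theorem norm_coe_onb₆ {ι : Type*} [Fintype ι] {S : Submodule ℂ (EuclideanSpace ℂ d)}
    (b : OrthonormalBasis ι ℂ S) (i : ι) : ‖(b i : EuclideanSpace ℂ d)‖ = 1 := by
  rw [Submodule.norm_coe]
  exact b.orthonormal.1 i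

/-- `‖Σᵢ c̄ᵢ eᵢ‖² = Σᵢ |cᵢ|²` for an orthonormal basis of a subspace. [folklore] -/
private theorem norm_sq_sum_conj_smul_onb₆ {ι : Type*} [Fintype ι] {S : Submodule ℂ (EuclideanSpace ℂ d)}
    (b : OrthonormalBasis ι ℂ S) (v : ι → ℂ) :
    ‖((∑ i, conj (v i) • b i : S) : EuclideanSpace ℂ d)‖ ^ 2 = ∑ i, ‖v i‖ ^ 2 := by
  rw [Submodule.norm_coe]
  have h : (∑ i, conj (v i) • b i : S) = b.repr.symm (WithLp.toLp 2 fun i => conj (v i)) := by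
    rw [← OrthonormalBasis.sum_repr_symm]
  rw [h, LinearIsometryEquiv.norm_map, EuclideanSpace.norm_sq_eq]
  refine Finset.sum_congr rfl fun i _ => ?_
  simp

/-- The mode right-hand sides are linear: `H₁ − H₂` is the right-hand side of the differences.
[folklore] -/
private theorem modeRHS_sub (c : ℂ) (A : ℝ) (k : d → ℤ) (X₁ X₂ : ℂ) (F₁ F₂ G₁ G₂ : d → ℂ) :
    (c * X₁ + ((∑ j, (2 * Real.pi * I * (k j)) * F₁ j) + (A : ℂ) * ∑ j, (2 * Real.pi * I * (k j)) * G₁ j)) -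
        (c * X₂ + ((∑ j, (2 * Real.pi * I * (k j)) * F₂ j) + (A : ℂ) * ∑ j, (2 * Real.pi * I * (k j)) * G₂ j)) =
      c * (X₁ - X₂) + ((∑ j, (2 * Real.pi * I * (k j)) * (F₁ j - F₂ j)) +
        (A : ℂ) * ∑ j, (2 * Real.pi * I * (k j)) * (G₁ j - G₂ j)) := by
  simp only [mul_sub, Finset.sum_sub_distrib]
  ring

end LinearAlgebra

/-! ## Plancherel bound for the difference fluxes -/

section Plancherel

/-- **Plancherel bound for a difference of products**: if `p, q` are integrable, `z, v ∈ L²` and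
`‖p − q‖ ≤ M‖z‖ + δ‖v‖` a.e., then `∑ₖ ‖𝓕(p)(k) − 𝓕(q)(k)‖ₑ² ≤ 2M² ∫⁻‖z‖ₑ² + 2δ² ∫⁻‖v‖ₑ²`.
[cite: Grafakos2014, Prop. 3.2.7 (3)] -/
theorem tsum_enorm_sq_mFourierCoeff_sub_le {p q z v : UnitAddTorus d → EuclideanSpace ℝ d}
    (hp : Integrable p volume) (hq : Integrable q volume) (hz : MemLp z 2 volume) (hv : MemLp v 2 volume)
    {M δ : ℝ} (hM : 0 ≤ M) (hδ : 0 ≤ δ) (hbound : ∀ᵐ x ∂volume, ‖p x - q x‖ ≤ M * ‖z x‖ + δ * ‖v x‖) :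
    ∑' k, ‖mFourierCoeff (FunctionSpaces.EuclideanSpace.complexify ∘ p) k -
        mFourierCoeff (FunctionSpaces.EuclideanSpace.complexify ∘ q) k‖ₑ ^ 2 ≤
      2 * ENNReal.ofReal (M ^ 2) * (∫⁻ x, ‖z x‖ₑ ^ 2) + 2 * ENNReal.ofReal (δ ^ 2) * ∫⁻ x, ‖v x‖ₑ ^ 2 := by
  -- `g = p − q ∈ L²`
  have hg2 : MemLp (p - q) 2 volume := by
    refine MemLp.mono' ((hz.norm.const_mul M).add (hv.norm.const_mul δ)) (hp.1.sub hq.1) ?_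
    filter_upwards [hbound] with x hx
    simpa using hx
  -- the coefficients of the difference
  have hcoef : ∀ k, mFourierCoeff (FunctionSpaces.EuclideanSpace.complexify ∘ p) k -
      mFourierCoeff (FunctionSpaces.EuclideanSpace.complexify ∘ q) k =
      mFourierCoeff (FunctionSpaces.EuclideanSpace.complexify ∘ (p - q)) k := by
    intro k
    rw [FunctionSpaces.Torus.complexify_comp_sub,
      FunctionSpaces.Torus.mFourierCoeff_sub (FunctionSpaces.Torus.integrable_complexify_comp hp)
        (FunctionSpaces.Torus.integrable_complexify_comp hq)]
  simp_rw [hcoef]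
  rw [FunctionSpaces.Torus.tsum_enorm_sq_mFourierCoeff_complexify hg2]
  -- pointwise bound in `ℝ≥0∞`
  have hpt : ∀ᵐ x ∂volume, ‖(p - q) x‖ₑ ^ 2 ≤
      2 * ENNReal.ofReal (M ^ 2) * ‖z x‖ₑ ^ 2 + 2 * ENNReal.ofReal (δ ^ 2) * ‖v x‖ₑ ^ 2 := by
    filter_upwards [hbound] with x hx
    have hreal : ‖p x - q x‖ ^ 2 ≤ 2 * M ^ 2 * ‖z x‖ ^ 2 + 2 * δ ^ 2 * ‖v x‖ ^ 2 := by
      have h0 : 0 ≤ M * ‖z x‖ + δ * ‖v x‖ := by positivity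
      nlinarith [pow_le_pow_left₀ (norm_nonneg _) hx 2, sq_nonneg (M * ‖z x‖ - δ * ‖v x‖)]
    have e : ∀ (y : EuclideanSpace ℝ d), ‖y‖ₑ ^ 2 = ENNReal.ofReal (‖y‖ ^ 2) := fun y => by
      rw [← ofReal_norm, ENNReal.ofReal_pow (norm_nonneg _)]
    calc ‖(p - q) x‖ₑ ^ 2 = ENNReal.ofReal (‖p x - q x‖ ^ 2) := by rw [Pi.sub_apply, e]
      _ ≤ ENNReal.ofReal (2 * M ^ 2 * ‖z x‖ ^ 2 + 2 * δ ^ 2 * ‖v x‖ ^ 2) := ENNReal.ofReal_le_ofReal hreal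
      _ = 2 * ENNReal.ofReal (M ^ 2) * ‖z x‖ₑ ^ 2 + 2 * ENNReal.ofReal (δ ^ 2) * ‖v x‖ₑ ^ 2 := by
          rw [e (z x), e (v x), ENNReal.ofReal_add (by positivity) (by positivity),
            ENNReal.ofReal_mul (by positivity : (0 : ℝ) ≤ 2 * M ^ 2), ENNReal.ofReal_mul (by norm_num : (0 : ℝ) ≤ 2),
            ENNReal.ofReal_mul (by positivity : (0 : ℝ) ≤ 2 * δ ^ 2), ENNReal.ofReal_mul (by norm_num : (0 : ℝ) ≤ 2),
            ENNReal.ofReal_ofNat]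
  calc ∫⁻ x, ‖(p - q) x‖ₑ ^ 2
      ≤ ∫⁻ x, (2 * ENNReal.ofReal (M ^ 2) * ‖z x‖ₑ ^ 2 + 2 * ENNReal.ofReal (δ ^ 2) * ‖v x‖ₑ ^ 2) :=
        lintegral_mono_ae hpt
    _ = 2 * ENNReal.ofReal (M ^ 2) * (∫⁻ x, ‖z x‖ₑ ^ 2) + 2 * ENNReal.ofReal (δ ^ 2) * ∫⁻ x, ‖v x‖ₑ ^ 2 := by
        rw [lintegral_add_left' ((hz.1.aemeasurable.enorm.pow_const 2).const_mul _),
          lintegral_const_mul' _ _ (ENNReal.mul_ne_top ENNReal.ofNat_ne_top ENNReal.ofReal_ne_top),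
          lintegral_const_mul' _ _ (ENNReal.mul_ne_top ENNReal.ofNat_ne_top ENNReal.ofReal_ne_top)]

end Plancherel

/-! ## The modewise bound for the difference of two solutions with different carriers -/

section ModeBound

variable [DecidableEq d]

namespace IsWeakTensorPassiveVectorOn

variable {A T : ℝ} {𝔸 : Visc4 d} {b b' w u : ℝ → UnitAddTorus d → EuclideanSpace ℝ d}
  {w₀ : UnitAddTorus d → EuclideanSpace ℝ d}

/-- A bound on the squared modes of the products from the class slice facts. [folklore] -/
private theorem ae_norm_sq_products_le (h : IsWeakTensorPassiveVectorOn A T 𝔸 b w₀ w) {M : ℝ} (hM : 0 ≤ M)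
    (hbM : ∀ᵐ q ∂(((volume : Measure ℝ).restrict (Ioo 0 T)).prod (volume : Measure (UnitAddTorus d))),
      ‖b q.1 q.2‖ ≤ M) (k : d → ℤ) :
    ∃ C : ℝ≥0, ∀ j, ∀ᵐ τ ∂(volume.restrict (Ioo 0 T)),
      ‖mFourierCoeff (FunctionSpaces.EuclideanSpace.complexify ∘ fun x => b τ x j • w τ x) k‖ ^ 2 ≤ M ^ 2 * C ∧
      ‖mFourierCoeff (FunctionSpaces.EuclideanSpace.complexify ∘ fun x => w τ x j • b τ x) k‖ ^ 2 ≤ M ^ 2 * C := by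
  obtain ⟨C, hC⟩ := h.ae_lintegral_sq_le
  refine ⟨C, fun j => ?_⟩
  filter_upwards [h.ae_tsum_enorm_sq_mFourierCoeff_products_le hM hbM, hC] with τ hτ hτC
  have conv : ∀ (Y : EuclideanSpace ℂ d), ‖Y‖ₑ ^ 2 ≤ ENNReal.ofReal (M ^ 2) * C → ‖Y‖ ^ 2 ≤ M ^ 2 * C := by
    intro Y hY
    have h2 : ‖Y‖ₑ ^ 2 = ENNReal.ofReal (‖Y‖ ^ 2) := by
      rw [← ofReal_norm, ENNReal.ofReal_pow (norm_nonneg _)]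
    rw [h2, ← ENNReal.ofReal_coe_nnreal, ← ENNReal.ofReal_mul (sq_nonneg _)] at hY
    exact (ENNReal.ofReal_le_ofReal_iff (by positivity)).1 hY
  exact ⟨conv _ (((ENNReal.le_tsum k).trans (hτ.2 j).1).trans (mul_le_mul_right hτC _)),
    conv _ (((ENNReal.le_tsum k).trans (hτ.2 j).2).trans (mul_le_mul_right hτC _))⟩

set_option maxHeartbeats 800000 in
/-- **The modewise bound for the difference of two weak solutions with different carriers.** For
`w` (carrier `b`, `‖b‖ ≤ M` a.e.) and `u` (carrier `b'`, `‖b'‖ ≤ M'` a.e.) in the tensor class with the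
same tensor `NearIso 𝔸 lo hi`, `0 < lo`, the same coupling `A` and the same integrable datum `w₀`:
for every `k` and a.e. `t ∈ (0,T)`,
`‖ŵ(t)(k) − û(t)(k)‖² ≤ (d(1+A²)/(2 lo)) ∫_{(0,t]} ∑ⱼ (‖𝓕(bⱼw)(k) − 𝓕(b'ⱼu)(k)‖² + ‖𝓕(wⱼb)(k) − 𝓕(uⱼb')(k)‖²)`
(subtract the tested mode identities — the datum terms cancel — and run the coupled mode energy bound
of `PassiveVectorTensorUniqueness` in an orthonormal basis of `k^⊥`; Evans §7.1.2 Thm. 2).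
[cite: Evans2010, §7.1.2 Thm. 2] [cite: DiPernaLions1989, §II.1 (13)–(14)] -/
theorem ae_sq_norm_mFourierCoeff_sub_le (h₁ : IsWeakTensorPassiveVectorOn A T 𝔸 b w₀ w)
    (h₂ : IsWeakTensorPassiveVectorOn A T 𝔸 b' w₀ u) {lo hi : ℝ} (h𝔸 : NearIso 𝔸 lo hi) (hlo : 0 < lo)
    (hw₀ : Integrable w₀ volume) {M M' : ℝ} (hM : 0 ≤ M) (hM' : 0 ≤ M')
    (hbM : ∀ᵐ q ∂(((volume : Measure ℝ).restrict (Ioo 0 T)).prod (volume : Measure (UnitAddTorus d))),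
      ‖b q.1 q.2‖ ≤ M)
    (hbM' : ∀ᵐ q ∂(((volume : Measure ℝ).restrict (Ioo 0 T)).prod (volume : Measure (UnitAddTorus d))),
      ‖b' q.1 q.2‖ ≤ M') (k : d → ℤ) :
    ∀ᵐ t ∂(volume.restrict (Ioo 0 T)),
      ‖mFourierCoeff (FunctionSpaces.EuclideanSpace.complexify ∘ w t) k -
          mFourierCoeff (FunctionSpaces.EuclideanSpace.complexify ∘ u t) k‖ ^ 2 ≤
        (Fintype.card d * (1 + A ^ 2) / (2 * lo)) * ∫ τ in Ioc 0 t, ∑ j,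
          (‖mFourierCoeff (FunctionSpaces.EuclideanSpace.complexify ∘ fun x => b τ x j • w τ x) k -
              mFourierCoeff (FunctionSpaces.EuclideanSpace.complexify ∘ fun x => b' τ x j • u τ x) k‖ ^ 2 +
            ‖mFourierCoeff (FunctionSpaces.EuclideanSpace.complexify ∘ fun x => w τ x j • b τ x) k -
              mFourierCoeff (FunctionSpaces.EuclideanSpace.complexify ∘ fun x => u τ x j • b' τ x) k‖ ^ 2) := by
  set N : ℝ := FunctionSpaces.Torus.freqNormSq k with hN
  set X₁ : ℝ → EuclideanSpace ℂ d := fun t => mFourierCoeff (FunctionSpaces.EuclideanSpace.complexify ∘ w t) k with hX₁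
  set X₂ : ℝ → EuclideanSpace ℂ d := fun t => mFourierCoeff (FunctionSpaces.EuclideanSpace.complexify ∘ u t) k with hX₂
  set X : ℝ → EuclideanSpace ℂ d := fun t => X₁ t - X₂ t with hX
  set F₁ : d → ℝ → EuclideanSpace ℂ d := fun j τ =>
    mFourierCoeff (FunctionSpaces.EuclideanSpace.complexify ∘ fun x => b τ x j • w τ x) k with hF₁
  set F₂ : d → ℝ → EuclideanSpace ℂ d := fun j τ =>
    mFourierCoeff (FunctionSpaces.EuclideanSpace.complexify ∘ fun x => b' τ x j • u τ x) k with hF₂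
  set G₁ : d → ℝ → EuclideanSpace ℂ d := fun j τ =>
    mFourierCoeff (FunctionSpaces.EuclideanSpace.complexify ∘ fun x => w τ x j • b τ x) k with hG₁
  set G₂ : d → ℝ → EuclideanSpace ℂ d := fun j τ =>
    mFourierCoeff (FunctionSpaces.EuclideanSpace.complexify ∘ fun x => u τ x j • b' τ x) k with hG₂
  set F : d → ℝ → EuclideanSpace ℂ d := fun j τ => F₁ j τ - F₂ j τ with hF
  set G : d → ℝ → EuclideanSpace ℂ d := fun j τ => G₁ j τ - G₂ j τ with hG
  set γ : ℝ → ℝ := fun τ => ∑ j, (‖F j τ‖ ^ 2 + ‖G j τ‖ ^ 2) with hγ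
  have hN0 : 0 ≤ N := FunctionSpaces.Torus.freqNormSq_nonneg k
  have hXi : IntegrableOn X (Ioo 0 T) := (h₁.integrableOn_mFourierCoeff k).sub (h₂.integrableOn_mFourierCoeff k)
  have hFi : ∀ j, IntegrableOn (F j) (Ioo 0 T) := fun j =>
    (h₁.integrableOn_mFourierCoeff_carrier_smul j k).sub (h₂.integrableOn_mFourierCoeff_carrier_smul j k)
  have hGi : ∀ j, IntegrableOn (G j) (Ioo 0 T) := fun j =>
    (h₁.integrableOn_mFourierCoeff_smul_carrier j k).sub (h₂.integrableOn_mFourierCoeff_smul_carrier j k)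
  -- `γ` is integrable (bounded by the class bounds)
  obtain ⟨C₁, hC₁⟩ := h₁.ae_norm_sq_products_le hM hbM k
  obtain ⟨C₂, hC₂⟩ := h₂.ae_norm_sq_products_le hM' hbM' k
  have hFG : ∀ j, ∀ᵐ τ ∂(volume.restrict (Ioo 0 T)),
      ‖F j τ‖ ^ 2 ≤ 2 * (M ^ 2 * C₁ + M' ^ 2 * C₂) ∧ ‖G j τ‖ ^ 2 ≤ 2 * (M ^ 2 * C₁ + M' ^ 2 * C₂) := by
    intro j
    filter_upwards [hC₁ j, hC₂ j] with τ h1 h2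
    constructor
    · calc ‖F j τ‖ ^ 2 ≤ (‖F₁ j τ‖ + ‖F₂ j τ‖) ^ 2 := pow_le_pow_left₀ (norm_nonneg _) (norm_sub_le _ _) 2
        _ ≤ 2 * (‖F₁ j τ‖ ^ 2 + ‖F₂ j τ‖ ^ 2) := by nlinarith [sq_nonneg (‖F₁ j τ‖ - ‖F₂ j τ‖)]
        _ ≤ 2 * (M ^ 2 * C₁ + M' ^ 2 * C₂) := by nlinarith [h1.1, h2.1]
    · calc ‖G j τ‖ ^ 2 ≤ (‖G₁ j τ‖ + ‖G₂ j τ‖) ^ 2 := pow_le_pow_left₀ (norm_nonneg _) (norm_sub_le _ _) 2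
        _ ≤ 2 * (‖G₁ j τ‖ ^ 2 + ‖G₂ j τ‖ ^ 2) := by nlinarith [sq_nonneg (‖G₁ j τ‖ - ‖G₂ j τ‖)]
        _ ≤ 2 * (M ^ 2 * C₁ + M' ^ 2 * C₂) := by nlinarith [h1.2, h2.2]
  have hγi : IntegrableOn γ (Ioo 0 T) := by
    have hm : AEStronglyMeasurable γ (volume.restrict (Ioo 0 T)) :=
      Finset.aestronglyMeasurable_fun_sum _ fun j _ =>
        ((hFi j).aestronglyMeasurable.norm.pow 2).add ((hGi j).aestronglyMeasurable.norm.pow 2)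
    refine IntegrableOn.of_bound measure_Ioo_lt_top hm
      (∑ _j : d, (2 * (M ^ 2 * C₁ + M' ^ 2 * C₂) + 2 * (M ^ 2 * C₁ + M' ^ 2 * C₂))) ?_
    have hall : ∀ᵐ τ ∂(volume.restrict (Ioo 0 T)), ∀ j,
        ‖F j τ‖ ^ 2 ≤ 2 * (M ^ 2 * C₁ + M' ^ 2 * C₂) ∧ ‖G j τ‖ ^ 2 ≤ 2 * (M ^ 2 * C₁ + M' ^ 2 * C₂) :=
      ae_all_iff.2 fun j => hFG j
    filter_upwards [hall] with τ hτ
    rw [Real.norm_eq_abs, abs_of_nonneg (Finset.sum_nonneg fun j _ => by positivity)]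
    exact Finset.sum_le_sum fun j _ => add_le_add (hτ j).1 (hτ j).2
  have hγ0 : ∀ᵐ τ ∂(volume.restrict (Ioo 0 T)), 0 ≤ γ τ :=
    ae_of_all _ fun τ => Finset.sum_nonneg fun j _ => by positivity
  have hI0 : ∀ t, 0 ≤ ∫ τ in Ioc 0 t, γ τ := fun t =>
    setIntegral_nonneg measurableSet_Ioc fun τ _ => Finset.sum_nonneg fun j _ => by positivity
  have hD0 : 0 ≤ Fintype.card d * (1 + A ^ 2) / (2 * lo) := by positivity
  -- transversality of the difference
  have hdiv : ∀ᵐ t ∂(volume.restrict (Ioo 0 T)), ∑ j, (k j : ℂ) * X t j = 0 := by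
    filter_upwards [h₁.ae_sum_mul_mFourierCoeff_eq_zero k, h₂.ae_sum_mul_mFourierCoeff_eq_zero k] with t h1 h2
    rw [hX]
    simp only [PiLp.sub_apply, mul_sub, Finset.sum_sub_distrib]
    rw [hX₁, hX₂]
    simp only at h1 h2 ⊢
    rw [h1, h2, sub_zero]
  by_cases hk : k = 0
  · -- `k = 0`: both zero modes equal the datum's, so the difference vanishes
    subst hk
    filter_upwards [h₁.ae_mFourierCoeff_zero_eq hw₀, h₂.ae_mFourierCoeff_zero_eq hw₀] with t ht1 ht2
    rw [ht1, ht2, sub_self, norm_zero]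
    simp only [ne_eq, OfNat.ofNat_ne_zero, not_false_eq_true, zero_pow]
    exact mul_nonneg hD0 (hI0 t)
  · -- `k ≠ 0`: coupled system in an orthonormal basis of `k^⊥`
    set S : Submodule ℂ (EuclideanSpace ℂ d) :=
      (ℂ ∙ (WithLp.toLp 2 (fun j => ((k j : ℤ) : ℂ)) : EuclideanSpace ℂ d))ᗮ with hS
    let bS := stdOrthonormalBasis ℂ S
    set e : Fin (Module.finrank ℂ S) → EuclideanSpace ℂ d := fun i => (bS i : EuclideanSpace ℂ d) with he
    have he_tr : ∀ i, ∑ j, (k j : ℂ) * e i j = 0 := fun i =>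
      (mem_orthogonal_waveVec_iff k _).1 (bS i).2
    have he_norm : ∀ i, ‖e i‖ = 1 := fun i => norm_coe_onb₆ bS i
    -- the coupled data
    set c : Fin (Module.finrank ℂ S) → ℝ → ℂ := fun i t => ⟪X t, e i⟫_ℂ with hc
    set β : Fin (Module.finrank ℂ S) → ℝ → ℂ := fun i τ =>
      (∑ j, (2 * Real.pi * I * (k j)) * ⟪F j τ, e i⟫_ℂ) +
        (A : ℂ) * ∑ j, (2 * Real.pi * I * (k j)) * ⟪G j τ, e i⟫_ℂ with hβ
    set Mm : Fin (Module.finrank ℂ S) → Fin (Module.finrank ℂ S) → ℂ := fun i i' =>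
      ((4 * Real.pi ^ 2 : ℝ) : ℂ) * ⟪e i', symbT 𝔸 k (e i)⟫_ℂ with hMm
    set ν : ℝ := 4 * Real.pi ^ 2 * lo * N with hν
    set D : ℝ := Fintype.card (Fin (Module.finrank ℂ S)) * (1 + A ^ 2) / (2 * lo) with hD
    have hν0 : 0 ≤ ν := by positivity
    have hD0' : 0 ≤ D := by positivity
    have hci : ∀ i, IntegrableOn (c i) (Ioo 0 T) := fun i => hXi.inner_const (e i)
    have hβi : ∀ i, IntegrableOn (β i) (Ioo 0 T) := by
      intro i
      have h1 : IntegrableOn (fun τ => ∑ j, (2 * Real.pi * I * (k j)) * ⟪F j τ, e i⟫_ℂ) (Ioo 0 T) :=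
        integrable_finsetSum _ fun j _ => ((hFi j).inner_const (e i)).const_mul _
      have h2 : IntegrableOn (fun τ => (A : ℂ) * ∑ j, (2 * Real.pi * I * (k j)) * ⟪G j τ, e i⟫_ℂ) (Ioo 0 T) :=
        (integrable_finsetSum _ fun j _ => ((hGi j).inner_const (e i)).const_mul _).const_mul _
      exact h1.add h2
    -- coercivity of `Mm`
    have hMcoer : ∀ v : Fin (Module.finrank ℂ S) → ℂ,
        ν * ∑ i, ‖v i‖ ^ 2 ≤ (∑ i, conj (v i) * ∑ i', Mm i i' * v i').re := by
      intro v
      set YS : S := ∑ i, conj (v i) • bS i with hYS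
      set Y : EuclideanSpace ℂ d := (YS : EuclideanSpace ℂ d) with hY
      have hYe : Y = ∑ i, conj (v i) • e i := by
        rw [hY, hYS, Submodule.coe_sum]
        rfl
      have hYtr : ∑ j, (k j : ℂ) * Y j = 0 := (mem_orthogonal_waveVec_iff k Y).1 YS.2
      have hYnorm : ‖Y‖ ^ 2 = ∑ i, ‖v i‖ ^ 2 := norm_sq_sum_conj_smul_onb₆ bS v
      have hform : ∑ i, conj (v i) * ∑ i', Mm i i' * v i' = ((4 * Real.pi ^ 2 : ℝ) : ℂ) * ⟪Y, symbT 𝔸 k Y⟫_ℂ := by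
        rw [hYe, symbT_sum, sum_inner, Finset.mul_sum]
        simp_rw [inner_sum, Finset.mul_sum]
        conv_lhs => rw [Finset.sum_comm]
        refine Finset.sum_congr rfl fun p _ => Finset.sum_congr rfl fun q _ => ?_
        rw [symbT_smul, inner_smul_left, inner_smul_right, Complex.conj_conj, hMm]
        ring
      have hcoer := lo_mul_le_re_inner_symbT h𝔸 hYtr
      rw [hform, Complex.re_ofReal_mul, ← hYnorm, hν]
      nlinarith [hcoer, Real.pi_pos]
    -- the coupled integral identities (subtract the two tested identities; the datum cancels)
    have heq : ∀ i, ∀ᵐ t ∂(volume.restrict (Ioo 0 T)),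
        c i t = ∫ s in Ioc 0 t, (-(∑ i', Mm i i' * c i' s) + β i s) := by
      intro i
      have hexp : ∀ᵐ s ∂(volume.restrict (Ioo 0 T)),
          (-(4 * Real.pi ^ 2 : ℝ) : ℂ) * ⟪X s, symbT 𝔸 k (e i)⟫_ℂ = -(∑ i', Mm i i' * c i' s) := by
        filter_upwards [hdiv] with s hs
        have hXS : X s ∈ S := (mem_orthogonal_waveVec_iff k (X s)).2 hs
        have hXe : X s = ∑ i', ⟪e i', X s⟫_ℂ • e i' := (sum_inner_smul_onb₆ bS hXS).symm
        conv_lhs => rw [hXe]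
        rw [sum_inner, Finset.mul_sum, ← Finset.sum_neg_distrib]
        refine Finset.sum_congr rfl fun i' _ => ?_
        rw [inner_smul_left, inner_conj_symm, hMm, hc]
        simp only
        push_cast
        ring
      have hH₁ := h₁.integrableOn_modeRHS k (e i)
      have hH₂ := h₂.integrableOn_modeRHS k (e i)
      filter_upwards [h₁.ae_inner_mFourierCoeff_eq hw₀ k (he_tr i), h₂.ae_inner_mFourierCoeff_eq hw₀ k (he_tr i),
        ae_restrict_mem measurableSet_Ioo] with t ht1 ht2 htT
      have hsub : Ioc 0 t ⊆ Ioo 0 T := Ioc_subset_Ioo_right htT.2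
      rw [hc]
      simp only
      rw [hX]
      simp only
      rw [inner_sub_left, ht1, ht2, add_sub_add_left_eq_sub,
        ← integral_sub (IntegrableOn.mono_set hH₁ hsub) (IntegrableOn.mono_set hH₂ hsub)]
      refine setIntegral_congr_ae measurableSet_Ioc ?_
      have h1 : ∀ᵐ s ∂(volume : Measure ℝ), s ∈ Ioo 0 T →
          (-(4 * Real.pi ^ 2 : ℝ) : ℂ) * ⟪X s, symbT 𝔸 k (e i)⟫_ℂ = -(∑ i', Mm i i' * c i' s) :=
        (ae_restrict_iff' measurableSet_Ioo).1 hexp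
      filter_upwards [h1] with s hs hst
      have hs' : s ∈ Ioo 0 T := ⟨hst.1, hst.2.trans_lt htT.2⟩
      rw [modeRHS_sub, ← inner_sub_left]
      simp_rw [← inner_sub_left]
      rw [← hs hs']
    -- the bound on `Σᵢ |βᵢ|²`
    have hbound : ∀ᵐ s ∂(volume.restrict (Ioo 0 T)), ∑ i, ‖β i s‖ ^ 2 ≤ 2 * ν * D * γ s := by
      refine ae_of_all _ fun s => ?_
      have hper : ∀ i, ‖β i s‖ ^ 2 ≤ (4 * Real.pi ^ 2 * N) * ((1 + A ^ 2) * γ s) := by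
        intro i
        have h1 := norm_sq_modeRHS_le₆ A k (e i) (fun j => F j s) (fun j => G j s)
        rw [he_norm i, one_pow, one_mul] at h1
        exact h1
      calc ∑ i, ‖β i s‖ ^ 2 ≤ ∑ _i : Fin (Module.finrank ℂ S), (4 * Real.pi ^ 2 * N) * ((1 + A ^ 2) * γ s) :=
            Finset.sum_le_sum fun i _ => hper i
        _ = Fintype.card (Fin (Module.finrank ℂ S)) * ((4 * Real.pi ^ 2 * N) * ((1 + A ^ 2) * γ s)) := by
            rw [Finset.sum_const, Finset.card_univ, nsmul_eq_mul]
        _ = 2 * ν * D * γ s := by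
            rw [hν, hD]
            field_simp
    -- the coupled-family energy bound
    have hfam := sum_sq_norm_le_of_ae_eq_setIntegral hν0 hD0' Mm hMcoer hci hβi hγi hγ0 heq hbound
    have hcard : (Fintype.card (Fin (Module.finrank ℂ S)) : ℝ) ≤ Fintype.card d := by
      rw [Fintype.card_fin]
      have h1 : Module.finrank ℂ S ≤ Module.finrank ℂ (EuclideanSpace ℂ d) := Submodule.finrank_le S
      rw [finrank_euclideanSpace] at h1
      exact_mod_cast h1
    have hDle : D ≤ Fintype.card d * (1 + A ^ 2) / (2 * lo) := by
      rw [hD]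
      exact div_le_div_of_nonneg_right (mul_le_mul_of_nonneg_right hcard (by positivity)) (by positivity)
    filter_upwards [hfam, hdiv] with t ht htdiv
    have hXS : X t ∈ S := (mem_orthogonal_waveVec_iff k (X t)).2 htdiv
    have hPars : ∑ i, ‖c i t‖ ^ 2 = ‖X t‖ ^ 2 := sum_sq_norm_inner_onb₆ bS hXS
    have hgoal : ‖X t‖ ^ 2 ≤ (Fintype.card d * (1 + A ^ 2) / (2 * lo)) * ∫ τ in Ioc 0 t, γ τ := by
      rw [← hPars]
      exact ht.trans (mul_le_mul_of_nonneg_right hDle (hI0 t))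
    exact hgoal

/-! ## The stability estimate -/

set_option maxHeartbeats 800000 in
/-- **`L²` stability of weak passive-vector solutions under `L^∞` perturbations of the carrier.**
For `w` (carrier `b`, `‖b‖ ≤ M`) and `u` (carrier `b'`, `‖b'‖ ≤ M'`, `‖b − b'‖ ≤ δ`, all a.e. on
`(0,T) × T^d`) in the tensor class with the same tensor `NearIso 𝔸 lo hi`, `0 < lo`, the same
coupling `A` and the same datum `w₀ ∈ L¹`: for a.e. `t ∈ (0,T)`,
`∫⁻ ‖w(t) − u(t)‖ₑ² ≤ K δ² (∫⁻_{(0,T)} ∫⁻ ‖u‖ₑ²) · exp(K M² t)`, `K = 2 d² (1+A²)/lo`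
(sum of the modewise bounds by Plancherel, `∑ₖ γₖ ≤ 4d (M²‖w − u‖² + δ²‖u‖²)`, and Grönwall a.e.
in time). With `δ = 0` this is uniqueness. [cite: Evans2010, §7.1.2 Thm. 2]
[cite: DiPernaLions1989, §II.1 Thm. II.1] -/
theorem ae_lintegral_sq_sub_le_of_carriers (h₁ : IsWeakTensorPassiveVectorOn A T 𝔸 b w₀ w)
    (h₂ : IsWeakTensorPassiveVectorOn A T 𝔸 b' w₀ u) {lo hi : ℝ} (h𝔸 : NearIso 𝔸 lo hi) (hlo : 0 < lo)
    (hw₀ : Integrable w₀ volume) {M M' δ : ℝ} (hM : 0 ≤ M) (hM' : 0 ≤ M') (hδ : 0 ≤ δ)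
    (hbM : ∀ᵐ q ∂(((volume : Measure ℝ).restrict (Ioo 0 T)).prod (volume : Measure (UnitAddTorus d))),
      ‖b q.1 q.2‖ ≤ M)
    (hbM' : ∀ᵐ q ∂(((volume : Measure ℝ).restrict (Ioo 0 T)).prod (volume : Measure (UnitAddTorus d))),
      ‖b' q.1 q.2‖ ≤ M')
    (hδb : ∀ᵐ q ∂(((volume : Measure ℝ).restrict (Ioo 0 T)).prod (volume : Measure (UnitAddTorus d))),
      ‖b q.1 q.2 - b' q.1 q.2‖ ≤ δ) :
    ∀ᵐ t ∂(volume.restrict (Ioo 0 T)),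
      ∫⁻ x, ‖w t x - u t x‖ₑ ^ 2 ≤
        ENNReal.ofReal (2 * (Fintype.card d : ℝ) ^ 2 * (1 + A ^ 2) / lo * δ ^ 2) *
          (∫⁻ s in Ioo 0 T, ∫⁻ x, ‖u s x‖ₑ ^ 2) *
          ENNReal.ofReal (Real.exp (2 * (Fintype.card d : ℝ) ^ 2 * (1 + A ^ 2) / lo * M ^ 2 * t)) := by
  obtain ⟨C₁, hC₁⟩ := h₁.ae_lintegral_sq_le
  obtain ⟨C₂, hC₂⟩ := h₂.ae_lintegral_sq_le
  set D : ℝ := Fintype.card d * (1 + A ^ 2) / (2 * lo) with hD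
  have hD0 : 0 ≤ D := by positivity
  set Φ : ℝ → ℝ≥0∞ := fun t => ∫⁻ x, ‖w t x - u t x‖ₑ ^ 2 with hΦ
  set Φu : ℝ → ℝ≥0∞ := fun t => ∫⁻ x, ‖u t x‖ₑ ^ 2 with hΦu
  set F : d → (d → ℤ) → ℝ → EuclideanSpace ℂ d := fun j k τ =>
    mFourierCoeff (FunctionSpaces.EuclideanSpace.complexify ∘ fun x => b τ x j • w τ x) k -
      mFourierCoeff (FunctionSpaces.EuclideanSpace.complexify ∘ fun x => b' τ x j • u τ x) k with hF
  set G : d → (d → ℤ) → ℝ → EuclideanSpace ℂ d := fun j k τ =>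
    mFourierCoeff (FunctionSpaces.EuclideanSpace.complexify ∘ fun x => w τ x j • b τ x) k -
      mFourierCoeff (FunctionSpaces.EuclideanSpace.complexify ∘ fun x => u τ x j • b' τ x) k with hG
  have hFi : ∀ j k, IntegrableOn (F j k) (Ioo 0 T) := fun j k =>
    (h₁.integrableOn_mFourierCoeff_carrier_smul j k).sub (h₂.integrableOn_mFourierCoeff_carrier_smul j k)
  have hGi : ∀ j k, IntegrableOn (G j k) (Ioo 0 T) := fun j k =>
    (h₁.integrableOn_mFourierCoeff_smul_carrier j k).sub (h₂.integrableOn_mFourierCoeff_smul_carrier j k)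
  -- ### Plancherel bound for the difference fluxes: `∑ₖ γₖ(τ) ≤ 4d (M² Φ τ + δ² Φu τ)` a.e.
  have hflux : ∀ᵐ τ ∂(volume.restrict (Ioo 0 T)),
      ∑' k, ∑ j, (‖F j k τ‖ₑ ^ 2 + ‖G j k τ‖ₑ ^ 2) ≤
        (Fintype.card d : ℝ≥0∞) * (2 * (2 * ENNReal.ofReal (M ^ 2) * Φ τ + 2 * ENNReal.ofReal (δ ^ 2) * Φu τ)) := by
    filter_upwards [h₁.ae_integrable_slice, h₂.ae_integrable_slice, h₁.ae_memLp_two, h₂.ae_memLp_two,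
      Measure.ae_ae_of_ae_prod hbM, Measure.ae_ae_of_ae_prod hδb] with τ hs1 hs2 hm1 hm2 hbτ hδτ
    have hz : MemLp (fun x => w τ x - u τ x) 2 volume := hm1.sub hm2
    have hFj : ∀ j, ∑' k, ‖F j k τ‖ₑ ^ 2 ≤ 2 * ENNReal.ofReal (M ^ 2) * Φ τ + 2 * ENNReal.ofReal (δ ^ 2) * Φu τ := by
      intro j
      refine tsum_enorm_sq_mFourierCoeff_sub_le (hs1.2.1 j) (hs2.2.1 j) hz hm2 hM hδ ?_
      filter_upwards [hbτ, hδτ] with x hbx hδx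
      have e : b τ x j • w τ x - b' τ x j • u τ x = b τ x j • (w τ x - u τ x) + (b τ x j - b' τ x j) • u τ x := by
        rw [smul_sub, sub_smul]; abel
      rw [e]
      refine (norm_add_le _ _).trans (add_le_add ?_ ?_)
      · rw [norm_smul]
        exact mul_le_mul_of_nonneg_right ((PiLp.norm_apply_le (b τ x) j).trans hbx) (norm_nonneg _)
      · rw [norm_smul]
        refine mul_le_mul_of_nonneg_right ?_ (norm_nonneg _)
        have : ‖b τ x j - b' τ x j‖ ≤ ‖b τ x - b' τ x‖ := by
          have h := PiLp.norm_apply_le (b τ x - b' τ x) j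
          rwa [PiLp.sub_apply] at h
        exact this.trans hδx
    have hGj : ∀ j, ∑' k, ‖G j k τ‖ₑ ^ 2 ≤ 2 * ENNReal.ofReal (M ^ 2) * Φ τ + 2 * ENNReal.ofReal (δ ^ 2) * Φu τ := by
      intro j
      refine tsum_enorm_sq_mFourierCoeff_sub_le (hs1.2.2 j) (hs2.2.2 j) hz hm2 hM hδ ?_
      filter_upwards [hbτ, hδτ] with x hbx hδx
      have e : w τ x j • b τ x - u τ x j • b' τ x = (w τ x j - u τ x j) • b τ x + u τ x j • (b τ x - b' τ x) := by
        rw [sub_smul, smul_sub]; abel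
      rw [e]
      refine (norm_add_le _ _).trans (add_le_add ?_ ?_)
      · rw [norm_smul, mul_comm]
        refine mul_le_mul hbx ?_ (norm_nonneg _) hM
        have h := PiLp.norm_apply_le (w τ x - u τ x) j
        rwa [PiLp.sub_apply] at h
      · rw [norm_smul, mul_comm]
        exact mul_le_mul hδx (PiLp.norm_apply_le (u τ x) j) (norm_nonneg _) hδ
    rw [Summable.tsum_finsetSum (fun _ _ => ENNReal.summable)]
    calc ∑ j, ∑' k, (‖F j k τ‖ₑ ^ 2 + ‖G j k τ‖ₑ ^ 2)
        ≤ ∑ _j : d, 2 * (2 * ENNReal.ofReal (M ^ 2) * Φ τ + 2 * ENNReal.ofReal (δ ^ 2) * Φu τ) := by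
          refine Finset.sum_le_sum fun j _ => ?_
          rw [ENNReal.tsum_add, two_mul]
          exact add_le_add (hFj j) (hGj j)
      _ = (Fintype.card d : ℝ≥0∞) * (2 * (2 * ENNReal.ofReal (M ^ 2) * Φ τ + 2 * ENNReal.ofReal (δ ^ 2) * Φu τ)) := by
          rw [Finset.sum_const, Finset.card_univ, nsmul_eq_mul]
  -- ### all modewise bounds at once
  have hmodes : ∀ᵐ t ∂(volume.restrict (Ioo 0 T)), ∀ k : d → ℤ,
      ‖mFourierCoeff (FunctionSpaces.EuclideanSpace.complexify ∘ w t) k -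
          mFourierCoeff (FunctionSpaces.EuclideanSpace.complexify ∘ u t) k‖ ^ 2 ≤
        D * ∫ τ in Ioc 0 t, ∑ j, (‖F j k τ‖ ^ 2 + ‖G j k τ‖ ^ 2) :=
    ae_all_iff.2 fun k => ae_sq_norm_mFourierCoeff_sub_le h₁ h₂ h𝔸 hlo hw₀ hM hM' hbM hbM' k
  -- ### integrability of the `γₖ`
  have hγi : ∀ k, IntegrableOn (fun τ => ∑ j, (‖F j k τ‖ ^ 2 + ‖G j k τ‖ ^ 2)) (Ioo 0 T) := by
    intro k
    obtain ⟨K₁, hK₁⟩ := h₁.ae_norm_sq_products_le hM hbM k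
    obtain ⟨K₂, hK₂⟩ := h₂.ae_norm_sq_products_le hM' hbM' k
    have hm : AEStronglyMeasurable (fun τ => ∑ j, (‖F j k τ‖ ^ 2 + ‖G j k τ‖ ^ 2)) (volume.restrict (Ioo 0 T)) :=
      Finset.aestronglyMeasurable_fun_sum _ fun j _ =>
        ((hFi j k).aestronglyMeasurable.norm.pow 2).add ((hGi j k).aestronglyMeasurable.norm.pow 2)
    refine IntegrableOn.of_bound measure_Ioo_lt_top hm
      (∑ _j : d, (2 * (M ^ 2 * K₁ + M' ^ 2 * K₂) + 2 * (M ^ 2 * K₁ + M' ^ 2 * K₂))) ?_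
    have hall₁ := ae_all_iff.2 hK₁
    have hall₂ := ae_all_iff.2 hK₂
    filter_upwards [hall₁, hall₂] with τ h1 h2
    rw [Real.norm_eq_abs, abs_of_nonneg (Finset.sum_nonneg fun j _ => by positivity)]
    refine Finset.sum_le_sum fun j _ => add_le_add ?_ ?_
    · calc ‖F j k τ‖ ^ 2 ≤ (‖mFourierCoeff (FunctionSpaces.EuclideanSpace.complexify ∘ fun x => b τ x j • w τ x) k‖ +
            ‖mFourierCoeff (FunctionSpaces.EuclideanSpace.complexify ∘ fun x => b' τ x j • u τ x) k‖) ^ 2 :=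
            pow_le_pow_left₀ (norm_nonneg _) (norm_sub_le _ _) 2
        _ ≤ 2 * (M ^ 2 * K₁ + M' ^ 2 * K₂) := by
            nlinarith [(h1 j).1, (h2 j).1,
              sq_nonneg (‖mFourierCoeff (FunctionSpaces.EuclideanSpace.complexify ∘ fun x => b τ x j • w τ x) k‖ -
                ‖mFourierCoeff (FunctionSpaces.EuclideanSpace.complexify ∘ fun x => b' τ x j • u τ x) k‖)]
    · calc ‖G j k τ‖ ^ 2 ≤ (‖mFourierCoeff (FunctionSpaces.EuclideanSpace.complexify ∘ fun x => w τ x j • b τ x) k‖ +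
            ‖mFourierCoeff (FunctionSpaces.EuclideanSpace.complexify ∘ fun x => u τ x j • b' τ x) k‖) ^ 2 :=
            pow_le_pow_left₀ (norm_nonneg _) (norm_sub_le _ _) 2
        _ ≤ 2 * (M ^ 2 * K₁ + M' ^ 2 * K₂) := by
            nlinarith [(h1 j).2, (h2 j).2,
              sq_nonneg (‖mFourierCoeff (FunctionSpaces.EuclideanSpace.complexify ∘ fun x => w τ x j • b τ x) k‖ -
                ‖mFourierCoeff (FunctionSpaces.EuclideanSpace.complexify ∘ fun x => u τ x j • b' τ x) k‖)]
  -- ### the integral inequality for `Φ`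
  set L : ℝ≥0∞ := ENNReal.ofReal D * ((Fintype.card d : ℝ≥0∞) * (2 * (2 * ENNReal.ofReal (M ^ 2)))) with hL
  set Bc : ℝ≥0∞ := ENNReal.ofReal D * ((Fintype.card d : ℝ≥0∞) * (2 * (2 * ENNReal.ofReal (δ ^ 2)))) *
    ∫⁻ s in Ioo 0 T, Φu s with hBc
  have hLtop : L ≠ ⊤ := by
    rw [hL]
    exact ENNReal.mul_ne_top ENNReal.ofReal_ne_top (ENNReal.mul_ne_top (ENNReal.natCast_ne_top _)
      (ENNReal.mul_ne_top ENNReal.ofNat_ne_top (ENNReal.mul_ne_top ENNReal.ofNat_ne_top ENNReal.ofReal_ne_top)))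
  have hC₂' : ∀ᵐ τ ∂(volume : Measure ℝ), τ ∈ Ioo 0 T → Φu τ ≤ C₂ := (ae_restrict_iff' measurableSet_Ioo).1 hC₂
  have hIu : ∫⁻ s in Ioo 0 T, Φu s ≤ (C₂ : ℝ≥0∞) * volume (Ioo (0 : ℝ) T) := by
    rw [← setLIntegral_const]
    exact lintegral_mono_ae ((ae_restrict_iff' measurableSet_Ioo).2 (hC₂'.mono fun τ hτ hτt => hτ hτt))
  have hBtop : Bc ≠ ⊤ := by
    rw [hBc]
    refine ENNReal.mul_ne_top (ENNReal.mul_ne_top ENNReal.ofReal_ne_top (ENNReal.mul_ne_top (ENNReal.natCast_ne_top _)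
      (ENNReal.mul_ne_top ENNReal.ofNat_ne_top (ENNReal.mul_ne_top ENNReal.ofNat_ne_top ENNReal.ofReal_ne_top)))) ?_
    exact (lt_of_le_of_lt hIu (ENNReal.mul_lt_top ENNReal.coe_lt_top measure_Ioo_lt_top)).ne
  have hΦineq : ∀ᵐ t ∂(volume.restrict (Ioo 0 T)), Φ t ≤ Bc + L * ∫⁻ τ in Ioo 0 t, Φ τ := by
    filter_upwards [hmodes, h₁.ae_memLp_two, h₂.ae_memLp_two, ae_restrict_mem measurableSet_Ioo] with t ht hm1 hm2 htT
    have hsub : Ioc 0 t ⊆ Ioo 0 T := fun τ hτ => ⟨hτ.1, hτ.2.trans_lt htT.2⟩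
    have hz : MemLp (fun x => w t x - u t x) 2 volume := hm1.sub hm2
    rw [hΦ]
    simp only
    rw [← FunctionSpaces.Torus.tsum_enorm_sq_mFourierCoeff_complexify hz]
    -- the coefficients of the difference
    have hcoef : ∀ k, mFourierCoeff (FunctionSpaces.EuclideanSpace.complexify ∘ fun x => w t x - u t x) k =
        mFourierCoeff (FunctionSpaces.EuclideanSpace.complexify ∘ w t) k -
          mFourierCoeff (FunctionSpaces.EuclideanSpace.complexify ∘ u t) k := by
      intro k
      rw [show (fun x => w t x - u t x) = w t - u t from rfl, FunctionSpaces.Torus.complexify_comp_sub,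
        FunctionSpaces.Torus.mFourierCoeff_sub (FunctionSpaces.Torus.integrable_complexify_comp (hm1.integrable one_le_two))
          (FunctionSpaces.Torus.integrable_complexify_comp (hm2.integrable one_le_two))]
    have hk : ∀ k, ‖mFourierCoeff (FunctionSpaces.EuclideanSpace.complexify ∘ fun x => w t x - u t x) k‖ₑ ^ 2 ≤
        ENNReal.ofReal D * ∫⁻ τ in Ioc 0 t, ∑ j, (‖F j k τ‖ₑ ^ 2 + ‖G j k τ‖ₑ ^ 2) := by
      intro k
      have hγt : Integrable (fun τ => ∑ j, (‖F j k τ‖ ^ 2 + ‖G j k τ‖ ^ 2)) (volume.restrict (Ioc 0 t)) :=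
        (hγi k).mono_set hsub
      have e1 : ‖mFourierCoeff (FunctionSpaces.EuclideanSpace.complexify ∘ fun x => w t x - u t x) k‖ₑ ^ 2 =
          ENNReal.ofReal (‖mFourierCoeff (FunctionSpaces.EuclideanSpace.complexify ∘ w t) k -
            mFourierCoeff (FunctionSpaces.EuclideanSpace.complexify ∘ u t) k‖ ^ 2) := by
        rw [hcoef, ← ofReal_norm, ENNReal.ofReal_pow (norm_nonneg _)]
      have e2 : ∫⁻ τ in Ioc 0 t, ∑ j, (‖F j k τ‖ₑ ^ 2 + ‖G j k τ‖ₑ ^ 2) =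
          ∫⁻ τ in Ioc 0 t, ENNReal.ofReal (∑ j, (‖F j k τ‖ ^ 2 + ‖G j k τ‖ ^ 2)) := by
        refine lintegral_congr fun τ => ?_
        rw [ENNReal.ofReal_sum_of_nonneg (fun j _ => by positivity)]
        refine Finset.sum_congr rfl fun j _ => ?_
        rw [ENNReal.ofReal_add (sq_nonneg _) (sq_nonneg _), ← ofReal_norm, ENNReal.ofReal_pow (norm_nonneg _),
          ← ofReal_norm, ENNReal.ofReal_pow (norm_nonneg _)]
      rw [e1, e2, ← ofReal_integral_eq_lintegral_ofReal hγt
          (ae_of_all _ fun τ => Finset.sum_nonneg fun j _ => by positivity), ← ENNReal.ofReal_mul hD0]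
      exact ENNReal.ofReal_le_ofReal (ht k)
    have hmeas : ∀ k, AEMeasurable (fun τ => ∑ j, (‖F j k τ‖ₑ ^ 2 + ‖G j k τ‖ₑ ^ 2)) (volume.restrict (Ioc 0 t)) := by
      intro k
      refine Finset.aemeasurable_fun_sum _ fun j _ => ?_
      exact (((hFi j k).aestronglyMeasurable.aemeasurable.mono_set hsub).enorm.pow_const 2).add
        (((hGi j k).aestronglyMeasurable.aemeasurable.mono_set hsub).enorm.pow_const 2)
    have hmeasΦ : AEMeasurable Φ (volume.restrict (Ioc 0 t)) := by
      have hm := ((h₁.aestronglyMeasurable_uncurry.sub h₂.aestronglyMeasurable_uncurry).enorm.pow_const 2).lintegral_prod_right'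
      exact (hm.mono_measure (Measure.restrict_mono hsub le_rfl))
    have hmeasΦu : AEMeasurable Φu (volume.restrict (Ioc 0 t)) := by
      have hm := (h₂.aestronglyMeasurable_uncurry.enorm.pow_const 2).lintegral_prod_right'
      exact (hm.mono_measure (Measure.restrict_mono hsub le_rfl))
    calc ∑' k, ‖mFourierCoeff (FunctionSpaces.EuclideanSpace.complexify ∘ fun x => w t x - u t x) k‖ₑ ^ 2
        ≤ ∑' k, ENNReal.ofReal D * ∫⁻ τ in Ioc 0 t, ∑ j, (‖F j k τ‖ₑ ^ 2 + ‖G j k τ‖ₑ ^ 2) :=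
          ENNReal.tsum_le_tsum hk
      _ = ENNReal.ofReal D * ∫⁻ τ in Ioc 0 t, ∑' k, ∑ j, (‖F j k τ‖ₑ ^ 2 + ‖G j k τ‖ₑ ^ 2) := by
          rw [ENNReal.tsum_mul_left, lintegral_tsum hmeas]
      _ ≤ ENNReal.ofReal D * ∫⁻ τ in Ioc 0 t,
            (Fintype.card d : ℝ≥0∞) * (2 * (2 * ENNReal.ofReal (M ^ 2) * Φ τ + 2 * ENNReal.ofReal (δ ^ 2) * Φu τ)) := by
          gcongr 1
          exact lintegral_mono_ae (ae_restrict_of_ae_restrict_of_subset hsub hflux)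
      _ = L * (∫⁻ τ in Ioc 0 t, Φ τ) +
            ENNReal.ofReal D * ((Fintype.card d : ℝ≥0∞) * (2 * (2 * ENNReal.ofReal (δ ^ 2)))) * ∫⁻ τ in Ioc 0 t, Φu τ := by
          rw [lintegral_const_mul' _ _ (ENNReal.natCast_ne_top _), lintegral_const_mul' _ _ ENNReal.ofNat_ne_top,
            lintegral_add_left' (hmeasΦ.const_mul _),
            lintegral_const_mul' _ _ (ENNReal.mul_ne_top ENNReal.ofNat_ne_top ENNReal.ofReal_ne_top),
            lintegral_const_mul' _ _ (ENNReal.mul_ne_top ENNReal.ofNat_ne_top ENNReal.ofReal_ne_top), hL]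
          ring
      _ ≤ L * (∫⁻ τ in Ioo 0 t, Φ τ) + Bc := by
          rw [setLIntegral_congr (Ioo_ae_eq_Ioc (μ := (volume : Measure ℝ))).symm, hBc]
          exact add_le_add le_rfl (mul_le_mul' le_rfl (lintegral_mono_set (Ioc_subset_Ioo_right htT.2)))
      _ = Bc + L * ∫⁻ τ in Ioo 0 t, Φ τ := add_comm _ _
  -- ### the `L^∞` bound on `Φ` and Grönwall
  have hΦM : ∀ᵐ t ∂(volume.restrict (Ioo 0 T)), Φ t ≤ (2 * (C₁ + C₂ : ℝ≥0) : ℝ≥0∞) := by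
    filter_upwards [hC₁, hC₂, h₁.ae_memLp_two, h₂.ae_memLp_two] with t h1 h2 hm1 hm2
    rw [hΦ]
    simp only
    calc ∫⁻ x, ‖w t x - u t x‖ₑ ^ 2 ≤ ∫⁻ x, (2 * ‖w t x‖ₑ ^ 2 + 2 * ‖u t x‖ₑ ^ 2) := by
          refine lintegral_mono fun x => ?_
          have e : ∀ (y : EuclideanSpace ℝ d), ‖y‖ₑ ^ 2 = ENNReal.ofReal (‖y‖ ^ 2) := fun y => by
            rw [← ofReal_norm, ENNReal.ofReal_pow (norm_nonneg _)]
          have hreal : ‖w t x - u t x‖ ^ 2 ≤ 2 * ‖w t x‖ ^ 2 + 2 * ‖u t x‖ ^ 2 := by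
            nlinarith [norm_sub_le (w t x) (u t x), sq_nonneg (‖w t x‖ - ‖u t x‖), norm_nonneg (w t x - u t x)]
          calc ‖w t x - u t x‖ₑ ^ 2 = ENNReal.ofReal (‖w t x - u t x‖ ^ 2) := e _
            _ ≤ ENNReal.ofReal (2 * ‖w t x‖ ^ 2 + 2 * ‖u t x‖ ^ 2) := ENNReal.ofReal_le_ofReal hreal
            _ = 2 * ‖w t x‖ₑ ^ 2 + 2 * ‖u t x‖ₑ ^ 2 := by
                rw [e (w t x), e (u t x), ENNReal.ofReal_add (by positivity) (by positivity),
                  ENNReal.ofReal_mul (by norm_num : (0 : ℝ) ≤ 2), ENNReal.ofReal_mul (by norm_num : (0 : ℝ) ≤ 2),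
                  ENNReal.ofReal_ofNat]
      _ = 2 * (∫⁻ x, ‖w t x‖ₑ ^ 2) + 2 * ∫⁻ x, ‖u t x‖ₑ ^ 2 := by
          rw [lintegral_add_left' ((hm1.1.aemeasurable.enorm.pow_const 2).const_mul _),
            lintegral_const_mul' _ _ ENNReal.ofNat_ne_top, lintegral_const_mul' _ _ ENNReal.ofNat_ne_top]
      _ ≤ 2 * (C₁ : ℝ≥0∞) + 2 * (C₂ : ℝ≥0∞) := add_le_add (mul_le_mul' le_rfl h1) (mul_le_mul' le_rfl h2)
      _ = (2 * (C₁ + C₂ : ℝ≥0) : ℝ≥0∞) := by push_cast; ring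
  have hGr := ae_gronwall_const (S := T) (φ := Φ) (B := Bc) (M := (2 * (C₁ + C₂ : ℝ≥0) : ℝ≥0∞)) (L := L)
    hBtop (by exact ENNReal.mul_ne_top ENNReal.ofNat_ne_top ENNReal.coe_ne_top) hLtop hΦM hΦineq
  filter_upwards [hGr] with t ht
  -- identify the constants
  have hLreal : L.toReal = 2 * (Fintype.card d : ℝ) ^ 2 * (1 + A ^ 2) / lo * M ^ 2 := by
    rw [hL, ENNReal.toReal_mul, ENNReal.toReal_mul, ENNReal.toReal_mul, ENNReal.toReal_mul, ENNReal.toReal_ofReal hD0,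
      ENNReal.toReal_natCast, ENNReal.toReal_ofNat, ENNReal.toReal_ofReal (sq_nonneg _), hD]
    field_simp
  have hBc' : Bc = ENNReal.ofReal (2 * (Fintype.card d : ℝ) ^ 2 * (1 + A ^ 2) / lo * δ ^ 2) * ∫⁻ s in Ioo 0 T, Φu s := by
    rw [hBc]
    congr 1
    rw [← ENNReal.ofReal_natCast, ← ENNReal.ofReal_ofNat 2, ← ENNReal.ofReal_mul (by norm_num),
      ← ENNReal.ofReal_mul (by norm_num), ← ENNReal.ofReal_mul (by positivity), ← ENNReal.ofReal_mul hD0]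
    congr 1
    rw [hD]
    field_simp
  rw [hLreal, hBc'] at ht
  exact ht

end IsWeakTensorPassiveVectorOn

end ModeBound

end Torus

end Literature.Analysis.FluidPDE

end
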